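import Mathlib
import HarnessLib
import Summits.Ventures.LatticeQCDFlow.Scoring.ReweightingMedianOfBlocks
import Summits.Ventures.LatticeQCDFlow.Scoring.RatioEstimatorConfidence

/-!
# The PRINTED (self-normalised) reweighting estimate WITHOUT a weight ceiling: the median over
# `R` blocks of `Σ_j w̃_j O_j / Σ_j w̃_j` is within `(t + B u)/(1 − u)` of `E_p O` with probability
# `≥ 1 − e^{−R/8}` as soon as `8B²M₂ ≤ m t²` and `8(M₂ − 1) ≤ m u²`

HONEST FRAMING: exact (Metropolis-corrected) sampling algorithms for lattice gauge theory;
figures of merit are autocorrelation/cost numbers at stated couplings and volumes; no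
continuum-physics claim.

Venture `LatticeQCDFlow` (cell pub-lqcd), topic `Scoring`; FANOUT row 4 (`s0-u1-b`, rung S0-B).
Sequel of row 4's `Scoring/ReweightingMedianOfBlocks` (imported: the UNNORMALISED block estimate
`Ê_r = Σ_j w_j O_j / m`, `w = p/q`, left the self-normalised ratio NOT CLAIMED).  A flow code holds
UNNORMALISED weights `w̃ = c·w` (`c = Z` unknown) and prints per block the self-normalised estimate

  `S_r = Σ_{j<m} w̃(y_{rm+j}) O(y_{rm+j}) / Σ_{j<m} w̃(y_{rm+j}) = Ê_r / W̄_r`   (scale-free),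

of `E_p O = ∫ p·O dμ`.  Per block, Chebyshev twice — `P(t ≤ |Ê_r − E_p O|) ≤ B²M₂/(m t²)`
(`ReweightingMedian.blockMean_chebyshev_iid` with `Var_q(wO) ≤ B²M₂`,
`ReweightingMedian.variance_weightMul_model_le`) and `P(u ≤ |W̄_r − 1|) ≤ (M₂ − 1)/(m u²)`
(`AllPairsMedian.meanWeight_chebyshev_iid`) — then row 8's deterministic ratio inequality
`Scoring.abs_div_sub_div_le` (`|A/B − a| ≤ (|A − a| + |a||B − 1|)/β` for `0 < β ≤ B`) with
`β = 1 − u` and `|E_p O| ≤ B`: block `r` is bad with probability `≤ 1/8 + 1/8`; the blocks are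
independent (`AllPairsMedian.iIndepFun_blockFun`) and `BlockMedian.measureReal_half_far_le`
concludes.  Inputs: `p ≥ 0` measurable with `∫ p = 1` and `p²/q ∈ L¹(μ)` (`M₂ = ∫ p²/q dμ = 1/ESS`,
stated as `Integrable`), `q > 0` measurable, `O` measurable with `|O| ≤ B`; NO ceiling `p ≤ Wq`.
NEW WORK of the cell (elementary); no definition is introduced; nothing is cited as a fact.

## Content

* `abs_integral_targetMul_le` (`|∫ p·O dμ| ≤ B`), `blockSelfNorm_scale_free` (`S_r` does not see
  `c`), `blockSelfNorm_eq_div` (`S_r = Ê_r / W̄_r`);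
* **`selfNormReweighting_medianOfBlocks_confidence`** — `m ≥ 1`, `R·m ≤ n`, `t > 0`, `0 < u < 1`,
  `8B²M₂ ≤ m t²`, `8(M₂ − 1) ≤ m u²`, any `c > 0`:
  `P( #{r < R : (t + Bu)/(1 − u) ≤ |S_r − ∫ p·O dμ|} ≥ R/2 ) ≤ exp(−R/8)`;
* **`selfNormReweighting_sampleMedian_confidence`** — the same for ANY sample-median selection
  `med(ω)` of the printed `S_0, …, S_{R−1}`: `P((t + Bu)/(1 − u) ≤ |med − ∫ p·O dμ|) ≤ exp(−R/8)`.

Reading (value-free): the observable a flow code prints per block by self-normalised reweighting is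
certified, with the effective sample size and a sup bound on the observable as the only inputs, to
`± (t + Bu)/(1 − u)` with `t ≈ B√(8M₂/m)`, `u ≈ √(8(M₂ − 1)/m)` at confidence `1 − e^{−R/8}`.
NOT CLAIMED: unbounded observables; estimating `M₂`; the bias of `S_r` (irrelevant to the
statement, which is about deviations from `E_p O` directly); any number of ours re-scored.
-/

noncomputable section

namespace Summit.Ventures.LatticeQCDFlow.Scoring.ReweightingMedian

open MeasureTheory ProbabilityTheory Finset Real Set
open Summit.Ventures.LatticeQCDFlow.Scoring.BlockMedian
open Summit.Ventures.LatticeQCDFlow.Scoring.AllPairsMedian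

section SelfNorm

variable {X : Type*} [MeasurableSpace X] {μ : Measure X} {p q O : X → ℝ}

/-- `|E_p O| = |∫ p·O dμ| ≤ B` for a normalised target `p ≥ 0` and `|O| ≤ B` measurable. [ours] -/
theorem abs_integral_targetMul_le (hp0 : ∀ z, 0 ≤ p z) (hpi : Integrable p μ)
    (hp1 : ∫ z, p z ∂μ = 1) {B : ℝ} (hOB : ∀ z, |O z| ≤ B) :
    |∫ z, p z * O z ∂μ| ≤ B := by
  calc |∫ z, p z * O z ∂μ| ≤ ∫ z, |p z * O z| ∂μ := abs_integral_le_integral_abs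
    _ ≤ ∫ z, p z * B ∂μ := by
        refine integral_mono_of_nonneg (Filter.Eventually.of_forall fun z => abs_nonneg _)
          (hpi.mul_const B) (Filter.Eventually.of_forall fun z => ?_)
        show |p z * O z| ≤ p z * B
        rw [abs_mul, abs_of_nonneg (hp0 z)]
        exact mul_le_mul_of_nonneg_left (hOB z) (hp0 z)
    _ = B := by rw [integral_mul_const, hp1, one_mul]

omit [MeasurableSpace X] in
/-- **The printed self-normalised block estimate is scale-free**: with `w̃ = c·(p/q)`, `c > 0`,
`Σ w̃_j O_j / Σ w̃_j = Σ w_j O_j / Σ w_j`. [ours] -/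
theorem blockSelfNorm_scale_free {wt : X → ℝ} {c : ℝ} (hc : 0 < c)
    (hwt : ∀ z, wt z = c * (p z / q z)) {m : ℕ} (v : Fin m → X) :
    (∑ j : Fin m, wt (v j) * O (v j)) / (∑ j : Fin m, wt (v j))
      = (∑ j : Fin m, p (v j) / q (v j) * O (v j)) / (∑ j : Fin m, p (v j) / q (v j)) := by
  have e1 : ∑ j : Fin m, wt (v j) * O (v j) = c * ∑ j : Fin m, p (v j) / q (v j) * O (v j) := by
    rw [Finset.mul_sum]
    exact Finset.sum_congr rfl fun j _ => by rw [hwt, mul_assoc]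
  have e2 : ∑ j : Fin m, wt (v j) = c * ∑ j : Fin m, p (v j) / q (v j) := by
    rw [Finset.mul_sum]
    exact Finset.sum_congr rfl fun j _ => hwt _
  rw [e1, e2, mul_div_mul_left _ _ hc.ne']

omit [MeasurableSpace X] in
/-- `Σ w_j O_j / Σ w_j = (Σ w_j O_j / m) / (Σ w_j / m)` (`m ≥ 1`). [ours] -/
theorem blockSelfNorm_eq_div {m : ℕ} (hm : 1 ≤ m) (v : Fin m → X) :
    (∑ j : Fin m, p (v j) / q (v j) * O (v j)) / (∑ j : Fin m, p (v j) / q (v j))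
      = ((∑ j : Fin m, p (v j) / q (v j) * O (v j)) / m)
          / ((∑ j : Fin m, p (v j) / q (v j)) / m) := by
  have hm0 : (m : ℝ) ≠ 0 := by exact_mod_cast (show m ≠ 0 by omega)
  rw [div_div_div_cancel_right₀ hm0]

variable {Ω : Type*} [MeasurableSpace Ω] {P : Measure Ω} [IsProbabilityMeasure P] {n m R : ℕ}

/-- **THE PRINTED SELF-NORMALISED REWEIGHTING ESTIMATE, CEILING-FREE, EXPONENTIAL CONFIDENCE.**
`n` independent model draws `y_j` (laws `μ.withDensity q`); `p ≥ 0` measurable, `∫ p = 1`,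
`p²/q ∈ L¹(μ)` (`M₂ = ∫ p²/q dμ`); `q > 0` measurable; `O` measurable, `|O| ≤ B`; weights printed
with ANY normalisation `w̃ = c·p/q`, `c > 0`; blocks of `m ≥ 1` draws, `R·m ≤ n`; `t > 0`,
`0 < u < 1` with `8B²M₂ ≤ m t²` and `8(M₂ − 1) ≤ m u²`.  With `S_r = Σ_j w̃_j O_j / Σ_j w̃_j` the
printed estimate of block `r`:
`P( #{r < R : (t + Bu)/(1 − u) ≤ |S_r − ∫ p·O dμ|} ≥ R/2 ) ≤ exp(−R/8)`. [ours] -/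
theorem selfNormReweighting_medianOfBlocks_confidence {y : Fin n → Ω → X}
    (hym : ∀ j, Measurable (y j)) (hind : iIndepFun y P) (hp0 : ∀ z, 0 ≤ p z)
    (hpm : Measurable p) (hpi : Integrable p μ) (hp1 : ∫ z, p z ∂μ = 1) (hq0 : ∀ z, 0 < q z)
    (hqm : Measurable q) (hM2i : Integrable (fun z => p z ^ 2 / q z) μ) (hOm : Measurable O)
    {B : ℝ} (hOB : ∀ z, |O z| ≤ B)
    (hlaw : ∀ j, Measure.map (y j) P = μ.withDensity fun z => ENNReal.ofReal (q z))
    {wt : X → ℝ} {c : ℝ} (hc : 0 < c) (hwt : ∀ z, wt z = c * (p z / q z))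
    (hm : 1 ≤ m) (hRm : R * m ≤ n) {t u : ℝ} (ht : 0 < t) (hu : 0 < u) (hu1 : u < 1)
    (hvt : 8 * (B ^ 2 * ∫ z, p z ^ 2 / q z ∂μ) ≤ m * t ^ 2)
    (hvu : 8 * ((∫ z, p z ^ 2 / q z ∂μ) - 1) ≤ m * u ^ 2) :
    P.real {ω | (R : ℝ) / 2 ≤ #{r ∈ (univ : Finset (Fin R)) | (t + B * u) / (1 - u) ≤
        |(∑ j : Fin m, wt (y ⟨((r : Fin R) : ℕ) * m + j, mul_add_lt hRm r j⟩ ω)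
              * O (y ⟨((r : Fin R) : ℕ) * m + j, mul_add_lt hRm r j⟩ ω))
            / (∑ j : Fin m, wt (y ⟨((r : Fin R) : ℕ) * m + j, mul_add_lt hRm r j⟩ ω))
          - ∫ z, p z * O z ∂μ|}} ≤ exp (-(R / 8)) := by
  rcases Nat.eq_zero_or_pos R with hR | hR
  · subst hR
    refine measureReal_le_one.trans ?_
    simp
  have hn : 0 < n := by
    have : 0 < R * m := Nat.mul_pos hR (by omega)
    omega
  have hν : IsProbabilityMeasure (μ.withDensity fun z => ENNReal.ofReal (q z)) :=
    isProbabilityMeasure_of_map_eq_iid (hym ⟨0, hn⟩) (hlaw ⟨0, hn⟩)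
  have ha : |∫ z, p z * O z ∂μ| ≤ B := abs_integral_targetMul_le hp0 hpi hp1 hOB
  have hB0 : 0 ≤ B := (abs_nonneg _).trans ha
  have hwtm : Measurable wt := by
    have : wt = fun z => c * (p z / q z) := funext hwt
    rw [this]
    exact (hpm.div hqm).const_mul c
  have hm0 : (0 : ℝ) < m := by exact_mod_cast hm
  -- the printed block estimate as a measurable function of the block; independence across blocks
  have hg : Measurable fun (v : Fin m → X) =>
      (∑ j : Fin m, wt (v j) * O (v j)) / (∑ j : Fin m, wt (v j)) :=
    (Finset.measurable_sum _ fun (j : Fin m) _ =>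
      (hwtm.comp (measurable_pi_apply j)).mul (hOm.comp (measurable_pi_apply j))).div
      (Finset.measurable_sum _ fun (j : Fin m) _ => hwtm.comp (measurable_pi_apply j))
  have hYind : iIndepFun (fun (r : Fin R) ω =>
      (∑ j : Fin m, wt (y ⟨(r : ℕ) * m + j, mul_add_lt hRm r j⟩ ω)
            * O (y ⟨(r : ℕ) * m + j, mul_add_lt hRm r j⟩ ω))
        / (∑ j : Fin m, wt (y ⟨(r : ℕ) * m + j, mul_add_lt hRm r j⟩ ω))) P :=
    iIndepFun_blockFun hym hind hRm hg
  have hYm : ∀ r : Fin R, Measurable fun ω =>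
      (∑ j : Fin m, wt (y ⟨(r : ℕ) * m + j, mul_add_lt hRm r j⟩ ω)
            * O (y ⟨(r : ℕ) * m + j, mul_add_lt hRm r j⟩ ω))
        / (∑ j : Fin m, wt (y ⟨(r : ℕ) * m + j, mul_add_lt hRm r j⟩ ω)) := fun r => by
    have hblk : Measurable fun ω => fun (i : Fin m) => y ⟨(r : ℕ) * m + i, mul_add_lt hRm r i⟩ ω :=
      measurable_pi_lambda _ fun i => hym _
    exact hg.comp hblk
  -- each block is bad with probability ≤ 1/8 + 1/8
  have hfar : ∀ r ∈ (univ : Finset (Fin R)), P.real {ω | (t + B * u) / (1 - u) ≤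
      |(∑ j : Fin m, wt (y ⟨(r : ℕ) * m + j, mul_add_lt hRm r j⟩ ω)
            * O (y ⟨(r : ℕ) * m + j, mul_add_lt hRm r j⟩ ω))
          / (∑ j : Fin m, wt (y ⟨(r : ℕ) * m + j, mul_add_lt hRm r j⟩ ω))
        - ∫ z, p z * O z ∂μ|} ≤ 1 / 4 := by
    intro r _
    -- Chebyshev for the unnormalised block estimate `Ê_r` and for the block mean weight `W̄_r`
    have hE := blockMean_chebyshev_iid (ν := μ.withDensity fun z => ENNReal.ofReal (q z))
      (x := fun (i : Fin m) => y ⟨(r : ℕ) * m + i, mul_add_lt hRm r i⟩) (fun i => hym _)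
      (iIndepFun_block hind hRm r) (fun i => hlaw _) (g := fun a => p a / q a * O a)
      ((hpm.div hqm).mul hOm) (memLp_weightMul_model hpm hq0 hqm hM2i hOm hOB) hm ht
    rw [integral_weightMul_model hq0 hqm] at hE
    have hEv := variance_weightMul_model_le hν hpm hq0 hqm hM2i hOm hOB
    have hW := meanWeight_chebyshev_iid
      (x := fun (i : Fin m) => y ⟨(r : ℕ) * m + i, mul_add_lt hRm r i⟩) (fun i => hym _)
      (iIndepFun_block hind hRm r) hpm hpi hp1 hq0 hqm hM2i (fun i => hlaw _) hm hu
    have hratio : ∀ ω,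
        (∑ j : Fin m, wt (y ⟨(r : ℕ) * m + j, mul_add_lt hRm r j⟩ ω)
              * O (y ⟨(r : ℕ) * m + j, mul_add_lt hRm r j⟩ ω))
          / (∑ j : Fin m, wt (y ⟨(r : ℕ) * m + j, mul_add_lt hRm r j⟩ ω))
        = ((∑ j : Fin m, p (y ⟨(r : ℕ) * m + j, mul_add_lt hRm r j⟩ ω)
              / q (y ⟨(r : ℕ) * m + j, mul_add_lt hRm r j⟩ ω)
              * O (y ⟨(r : ℕ) * m + j, mul_add_lt hRm r j⟩ ω)) / m)
          / ((∑ j : Fin m, p (y ⟨(r : ℕ) * m + j, mul_add_lt hRm r j⟩ ω)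
              / q (y ⟨(r : ℕ) * m + j, mul_add_lt hRm r j⟩ ω)) / m) := fun ω => by
      rw [blockSelfNorm_scale_free hc hwt fun i => y ⟨(r : ℕ) * m + i, mul_add_lt hRm r i⟩ ω,
        blockSelfNorm_eq_div hm]
    have hsub : {ω | (t + B * u) / (1 - u) ≤
          |(∑ j : Fin m, wt (y ⟨(r : ℕ) * m + j, mul_add_lt hRm r j⟩ ω)
                * O (y ⟨(r : ℕ) * m + j, mul_add_lt hRm r j⟩ ω))
              / (∑ j : Fin m, wt (y ⟨(r : ℕ) * m + j, mul_add_lt hRm r j⟩ ω))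
            - ∫ z, p z * O z ∂μ|}
        ⊆ {ω | t ≤ |(∑ j : Fin m, p (y ⟨(r : ℕ) * m + j, mul_add_lt hRm r j⟩ ω)
              / q (y ⟨(r : ℕ) * m + j, mul_add_lt hRm r j⟩ ω)
              * O (y ⟨(r : ℕ) * m + j, mul_add_lt hRm r j⟩ ω)) / m - ∫ z, p z * O z ∂μ|}
          ∪ {ω | u ≤ |(∑ j : Fin m, p (y ⟨(r : ℕ) * m + j, mul_add_lt hRm r j⟩ ω)
              / q (y ⟨(r : ℕ) * m + j, mul_add_lt hRm r j⟩ ω)) / m - 1|} := by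
      intro ω hω
      simp only [Set.mem_setOf_eq, Set.mem_union] at hω ⊢
      rw [hratio ω] at hω
      by_contra hcon
      simp only [not_or, not_le] at hcon
      obtain ⟨h1, h2⟩ := hcon
      set A := (∑ j : Fin m, p (y ⟨(r : ℕ) * m + j, mul_add_lt hRm r j⟩ ω)
          / q (y ⟨(r : ℕ) * m + j, mul_add_lt hRm r j⟩ ω)
          * O (y ⟨(r : ℕ) * m + j, mul_add_lt hRm r j⟩ ω)) / m with hA
      set W := (∑ j : Fin m, p (y ⟨(r : ℕ) * m + j, mul_add_lt hRm r j⟩ ω)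
          / q (y ⟨(r : ℕ) * m + j, mul_add_lt hRm r j⟩ ω)) / m with hW'
      set a := ∫ z, p z * O z ∂μ with ha'
      have hWlo : 1 - u ≤ W := by
        have := (abs_lt.1 h2).1
        linarith
      have key : |A / W - a| ≤ (|A - a| + |a| * |W - 1|) / (1 - u) := by
        simpa only [div_one] using abs_div_sub_div_le (A := A) (B := W) (a := a) (b := 1)
          (β := 1 - u) (by linarith) hWlo one_ne_zero
      have hnum : |A - a| + |a| * |W - 1| ≤ t + B * u := by
        have h3 : |a| * |W - 1| ≤ B * u :=
          mul_le_mul ha h2.le (abs_nonneg _) hB0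
        linarith [h1.le]
      have : |A / W - a| ≤ (t + B * u) / (1 - u) :=
        key.trans (div_le_div_of_nonneg_right hnum (by linarith))
      -- strictness: `|A − a| < t` makes the numerator strictly smaller
      have hnum' : |A - a| + |a| * |W - 1| < t + B * u := by
        have h3 : |a| * |W - 1| ≤ B * u :=
          mul_le_mul ha h2.le (abs_nonneg _) hB0
        linarith
      have hlt : |A / W - a| < (t + B * u) / (1 - u) :=
        key.trans_lt (div_lt_div_of_pos_right hnum' (by linarith))
      linarith
    have hE' : Var[fun a => p a / q a * O a; μ.withDensity fun z => ENNReal.ofReal (q z)]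
        / (m * t ^ 2) ≤ 1 / 8 := by
      rw [div_le_iff₀ (by positivity)]
      nlinarith [hEv]
    have hW' : ((∫ z, p z ^ 2 / q z ∂μ) - 1) / (m * u ^ 2) ≤ 1 / 8 := by
      rw [div_le_iff₀ (by positivity)]
      linarith
    calc P.real _ ≤ P.real _ := measureReal_mono hsub
      _ ≤ _ := measureReal_union_le _ _
      _ ≤ 1 / 8 + 1 / 8 := add_le_add (hE.trans hE') (hW.trans hW')
      _ = 1 / 4 := by norm_num
  have h := measureReal_half_far_le (μ := P) (univ : Finset (Fin R)) hYind hYm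
    (∫ z, p z * O z ∂μ) ((t + B * u) / (1 - u)) hfar
  simpa only [card_univ, Fintype.card_fin] using h

/-- **THE PRINTED SELF-NORMALISED ESTIMATE, CEILING-FREE, FOR ANY SAMPLE MEDIAN** `med(ω)` of the
`R` printed block estimates: under the same hypotheses,
`P((t + Bu)/(1 − u) ≤ |med − ∫ p·O dμ|) ≤ exp(−R/8)`. [ours] -/
theorem selfNormReweighting_sampleMedian_confidence {y : Fin n → Ω → X}
    (hym : ∀ j, Measurable (y j)) (hind : iIndepFun y P) (hp0 : ∀ z, 0 ≤ p z)
    (hpm : Measurable p) (hpi : Integrable p μ) (hp1 : ∫ z, p z ∂μ = 1) (hq0 : ∀ z, 0 < q z)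
    (hqm : Measurable q) (hM2i : Integrable (fun z => p z ^ 2 / q z) μ) (hOm : Measurable O)
    {B : ℝ} (hOB : ∀ z, |O z| ≤ B)
    (hlaw : ∀ j, Measure.map (y j) P = μ.withDensity fun z => ENNReal.ofReal (q z))
    {wt : X → ℝ} {c : ℝ} (hc : 0 < c) (hwt : ∀ z, wt z = c * (p z / q z))
    (hm : 1 ≤ m) (hRm : R * m ≤ n) {t u : ℝ} (ht : 0 < t) (hu : 0 < u) (hu1 : u < 1)
    (hvt : 8 * (B ^ 2 * ∫ z, p z ^ 2 / q z ∂μ) ≤ m * t ^ 2)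
    (hvu : 8 * ((∫ z, p z ^ 2 / q z ∂μ) - 1) ≤ m * u ^ 2) {med : Ω → ℝ}
    (hlo : ∀ ω, (R : ℝ) / 2 ≤ #{r ∈ (univ : Finset (Fin R)) | med ω ≤
        (∑ j : Fin m, wt (y ⟨((r : Fin R) : ℕ) * m + j, mul_add_lt hRm r j⟩ ω)
              * O (y ⟨((r : Fin R) : ℕ) * m + j, mul_add_lt hRm r j⟩ ω))
            / (∑ j : Fin m, wt (y ⟨((r : Fin R) : ℕ) * m + j, mul_add_lt hRm r j⟩ ω))})
    (hhi : ∀ ω, (R : ℝ) / 2 ≤ #{r ∈ (univ : Finset (Fin R)) |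
        (∑ j : Fin m, wt (y ⟨((r : Fin R) : ℕ) * m + j, mul_add_lt hRm r j⟩ ω)
              * O (y ⟨((r : Fin R) : ℕ) * m + j, mul_add_lt hRm r j⟩ ω))
            / (∑ j : Fin m, wt (y ⟨((r : Fin R) : ℕ) * m + j, mul_add_lt hRm r j⟩ ω))
          ≤ med ω}) :
    P.real {ω | (t + B * u) / (1 - u) ≤ |med ω - ∫ z, p z * O z ∂μ|} ≤ exp (-(R / 8)) := by
  refine (measureReal_mono ?_).trans
    (selfNormReweighting_medianOfBlocks_confidence hym hind hp0 hpm hpi hp1 hq0 hqm hM2i hOm hOB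
      hlaw hc hwt hm hRm ht hu hu1 hvt hvu)
  intro ω hω
  simp only [Set.mem_setOf_eq] at hω ⊢
  by_contra hlt
  push Not at hlt
  have hR : (#(univ : Finset (Fin R)) : ℝ) = R := by rw [card_univ, Fintype.card_fin]
  have h := abs_median_sub_lt_of_card_lt (univ : Finset (Fin R)) _ (hR ▸ hlo ω) (hR ▸ hhi ω)
    (hR ▸ hlt)
  linarith

end SelfNorm

end Summit.Ventures.LatticeQCDFlow.Scoring.ReweightingMedian

end
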